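import Summits.HubbardSuperconductivity.HubbardSuperconductivity.Theses.NodalWardXY
import Literature.MathematicalPhysics.QuantumLattice.BdGBondHamiltonianTorus
import Literature.MathematicalPhysics.QuantumLattice.XYOrderDischarges

/-!
# Disproof of `VisonPairCost` (route NodalWardXY, crux rank 2, item stmt-HubbardSuperconductivity-1266) — findings

Standing disprover's work file (cdisprove).  Prose lives in docstrings; everything else is Lean.
STATUS (cycle 1 final, 2026-08-16): NO KILL — the crux is very probably TRUE.  Exact BdG numerics to L = 56–64
(§6; 16 parameter points, every R) show `max_R |dE|` saturating at 0.5–1.9 for every `(μ,Δ₀)` in the crux range AND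
for every dropped hypothesis, obeying `dE = 2E_core + V(R) + c_L·R/L`; Kitaev 2006 §11 is the published cousin.
See the Index and `NOTES.md` / evidence `numerics_all.md`.

## Index
* §1  Named pieces: `sgn` (the Z₂ string), `bondTerm`, `visonH` (= the crux's `H R`), `dE`, and the
      faithful re-expression `visonPairCost_iff` (definitional).
* §2  QUANTIFIER ORDER.  `dE_bounded_fixedL`: for each fixed `L` the bound is trivial (finitely many `R`);
      the whole content of the crux is uniformity in `L` (sorry-free).
* §3  LOAD-BEARING ANALYSIS.  `sgn_of_le` / `visonH_of_le`: for `R ≥ L` the string is the full row, i.e.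
      `H R = H L` = the y-antiperiodic twist with NO vison, so dropping `2R ≤ L` only adds the twisted
      sector; `dE_zero`; numerics (kit j007910, this file's docstrings) for every dropped hypothesis.
* §4  NATURAL STRENGTHENINGS as named `Prop`s with their numerical status (uniform-in-(μ,Δ₀) constant,
      sign of the cost, monotonicity / `1/R` law, log fallback `VisonPairCostLog`).
* §5  THE TOOL any proof needs: `BdGNuclearNormFormula` — `E₀(H_R) = −μL² − ‖h_R + iΔ_R‖_*`
      (one-body `L²×L²` complex symmetric matrix), stated precisely; not yet a Lean theorem (needs the
      diagonalisation of fermionic quadratic forms, absent from the tree).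
* §6  NUMERICAL RECORD (docblock): the exact BdG tables, the holonomy-strip law `dE ≈ 2E_core + V(R) + c_L·R/L`
      with `c_L` = cost of the pure y-twist, the sign (`dE > 0`: visons COST energy, K2 not triggered), and
      WHY THE CRUX RESISTS.
* §7  NEAR-MISSES (the only `sorry`s): `visonPairCostNonneg_false` (numerically certain; needs §5 in Lean).
* LANDED (gate, ACCEPTED p73434, commit 5ebd8a3aeb9f): `Theorems/VisonPairCost/Negative/GaugeStructure.lean`
      = §1b without defs:
      `signedBondSum_eq_bdgTorus`, `cruxHamiltonian_eq_bdgTorus`, `visonPairCost_iff_bdgTorus`,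
      `groundEnergy_bdgTorus_z2Gauge`, `groundEnergy_unitary_conj'`, `phaseGauge_mem_unitaryGroup`.
-/

set_option linter.dupNamespace false

namespace Summit.HubbardSuperconductivity.HubbardSuperconductivity.Cruxes.VisonPairCost.Disproof

open scoped BigOperators Matrix ComplexConjugate
open Literature.MathematicalPhysics.QuantumLattice Literature.Probability.LatticeModels
open Summit.HubbardSuperconductivity.HubbardSuperconductivity.Theses.NodalWardXY

noncomputable section

/-! ## §1 Named pieces of the crux -/

/-- occupation-basis index of the Fock space over the `2L²` orbitals of `(ℤ/L)²`. -/
abbrev FockIdx (L : ℕ) : Type := Finset (Orb (FermionTorus 2 L))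
/-- operators on that Fock space. -/
abbrev Op (L : ℕ) : Type := Matrix (FockIdx L) (FockIdx L) ℂ

variable (L : ℕ)

/-- `c_{yσ}` (verbatim the crux's `c`). -/
def cOp [NeZero L] (y : TorusSite 2 L) (σ : Fin 2) : Op L :=
  annihilation (orb (FermionTorus.ofTorusSite y) σ)

/-- the Z₂ gauge field `s_R(x,i)`: `−1` exactly on the vertical bonds leaving `(a,0)`, `a < R`. -/
def sgn (R : ℕ) (x : TorusSite 2 L) (i : Fin 2) : ℂ :=
  if i = 1 ∧ x 1 = 0 ∧ (x 0).val < R then (-1 : ℂ) else 1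

/-- the bond term `−Σ_σ (c†_x c_{x+eᵢ} + h.c.) + Δ₀ gᵢ (P + P†)`, `P = c_{x↑}c_{x+eᵢ↓} − c_{x↓}c_{x+eᵢ↑}`,
`g = (+1,−1)` (verbatim the crux's summand). -/
def bondTerm [NeZero L] (Δ₀ : ℝ) (x : TorusSite 2 L) (i : Fin 2) : Op L :=
  (∑ σ : Fin 2, -((cOp L x σ)ᴴ * cOp L (x + Pi.single i 1) σ
      + (cOp L (x + Pi.single i 1) σ)ᴴ * cOp L x σ))
  + ((Δ₀ * (if i = 0 then (1 : ℝ) else -1) : ℝ) : ℂ) •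
      ((cOp L x 0 * cOp L (x + Pi.single i 1) 1 - cOp L x 1 * cOp L (x + Pi.single i 1) 0)
        + (cOp L x 0 * cOp L (x + Pi.single i 1) 1 - cOp L x 1 * cOp L (x + Pi.single i 1) 0)ᴴ)

/-- `H R` of the crux: the d-wave BdG Hamiltonian with the vison string of length `R`. -/
def visonH [NeZero L] (μ Δ₀ : ℝ) (R : ℕ) : Op L :=
  (∑ x : TorusSite 2 L, ∑ i : Fin 2, sgn L R x i • bondTerm L Δ₀ x i) - (μ : ℂ) • totalNumber

/-- the vison-pair cost `dE(L,R) = E₀(H_R) − E₀(H_0)`. -/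
def dE (μ Δ₀ : ℝ) (L : ℕ) [NeZero L] (R : ℕ) : ℝ :=
  (visonH L μ Δ₀ R).groundEnergy - (visonH L μ Δ₀ 0).groundEnergy

/-- The re-expression is faithful (definitional). -/
theorem visonPairCost_iff :
    VisonPairCost ↔
      ∀ μ : ℝ, μ ∈ Set.Ioo (-4 : ℝ) 4 → μ ≠ 0 → ∀ Δ₀ : ℝ, 0 < Δ₀ → ∃ C : ℝ,
        ∀ (L : ℕ) [NeZero L], 4 ≤ L → ∀ R : ℕ, 2 * R ≤ L → |dE μ Δ₀ L R| ≤ C := by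
  unfold VisonPairCost
  simp only [dE, visonH, bondTerm, sgn, cOp]


/-! ## §1b Bridge to the tree's `bdgTorus`: Hermiticity and Z₂ gauge invariance (sorry-free) -/

/-- the Z₂ field as a real sign. -/
def sgnR (R : ℕ) (x : TorusSite 2 L) (i : Fin 2) : ℝ :=
  if i = 1 ∧ x 1 = 0 ∧ (x 0).val < R then (-1 : ℝ) else 1

theorem sgn_eq_ofReal (R : ℕ) (x : TorusSite 2 L) (i : Fin 2) :
    sgn L R x i = ((sgnR L R x i : ℝ) : ℂ) := by
  unfold sgn sgnR
  split_ifs <;> simp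

/-- the `d_{x²−y²}` form factor on the two directions, `g = (+1, −1)`. -/
def gDir (i : Fin 2) : ℝ := if i = 0 then (1 : ℝ) else -1

/-- The d-wave BdG Hamiltonian with an ARBITRARY real bond field `s` multiplying hopping and pairing alike
(`s = sgnR R` is the crux's `H R`; a general `±1`-valued `s` is a general Z₂ gauge field = any vison
configuration with any holonomies). It is the tree's `bdgTorus` with bond data `τ = −s`, `Δ = s Δ₀ g`. -/
def z2H [NeZero L] (μ Δ₀ : ℝ) (s : TorusSite 2 L → Fin 2 → ℝ) : Op L :=
  bdgTorus L (fun x i => ((-(s x i) : ℝ) : ℂ)) (fun x i => ((s x i * (Δ₀ * gDir i) : ℝ) : ℂ)) μ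

/-- `H R` of the crux is `z2H` at the string field `sgnR R`. -/
theorem visonH_eq_z2H [NeZero L] (μ Δ₀ : ℝ) (R : ℕ) :
    visonH L μ Δ₀ R = z2H L μ Δ₀ (sgnR L R) := by
  unfold z2H
  rw [bdgTorus_ofReal]
  unfold visonH bondTerm
  congr 1
  refine Finset.sum_congr rfl fun x _ => Finset.sum_congr rfl fun i _ => ?_
  rw [sgn_eq_ofReal]
  simp only [cOp, torusBondHop_eq, torusBondPair_eq, Matrix.conjTranspose_mul, Matrix.conjTranspose_sub,
    annihilation_conjTranspose, creation_conjTranspose, gDir, smul_add, smul_sub, Finset.smul_sum, smul_neg,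
    smul_smul, Complex.ofReal_neg, Complex.ofReal_mul, neg_smul, Finset.sum_add_distrib,
    Finset.sum_neg_distrib, neg_add_rev]
  abel

/-- `H R` is Hermitian (so `Matrix.groundEnergy` is its least eigenvalue, no junk). -/
theorem visonH_isHermitian [NeZero L] (μ Δ₀ : ℝ) (R : ℕ) : (visonH L μ Δ₀ R).IsHermitian := by
  rw [visonH_eq_z2H]
  exact isHermitian_bdgTorus L _ _ μ

/-- `−1` on the unit circle. -/
def negOne : Circle := Circle.exp Real.pi

theorem coe_negOne : ((negOne : Circle) : ℂ) = -1 := by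
  rw [negOne, Circle.coe_exp, Complex.exp_pi_mul_I]

/-- a Z₂ gauge transformation `ε : sites → {±1}` as a `U(1)`-valued site function. -/
def signCircle (b : Bool) : Circle := if b then negOne else 1

/-- its value as a real sign. -/
def ηR (b : Bool) : ℝ := if b then (-1 : ℝ) else 1

theorem coe_signCircle (b : Bool) : ((signCircle b : Circle) : ℂ) = ((ηR b : ℝ) : ℂ) := by
  unfold signCircle ηR
  cases b <;> simp [coe_negOne]

theorem conj_coe_signCircle (b : Bool) : conj ((signCircle b : Circle) : ℂ) = ((ηR b : ℝ) : ℂ) := by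
  rw [coe_signCircle, Complex.conj_ofReal]

/-- `phaseGauge g` is unitary (generic `Λ`: at the concrete fermionic torus two `DecidableEq` instance paths
exist — `instDecidableEqLex` vs `LinearOrder.toDecidableEq` — so applications below go through `convert`). -/
theorem phaseGauge_mem_unitaryGroup {Λ : Type*} [LinearOrder Λ] [Fintype Λ] (g : Λ → Circle) :
    phaseGauge g ∈ Matrix.unitaryGroup (Finset (Orb Λ)) ℂ := by
  rw [Matrix.mem_unitaryGroup_iff, Matrix.star_eq_conjTranspose, phaseGauge, Matrix.diagonal_conjTranspose,
    Matrix.diagonal_mul_diagonal, ← Matrix.diagonal_one]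
  congr 1
  funext s
  rw [Pi.star_apply, Complex.star_def, ← Circle.coe_inv_eq_conj, ← Circle.coe_mul, mul_inv_cancel, Circle.coe_one]

/-- `Matrix.groundEnergy_unitary_conj` with the two `DecidableEq` instances decoupled (they are
propositionally equal, `Subsingleton`, but not definitionally at the concrete fermionic torus). -/
theorem groundEnergy_unitary_conj' {n : Type*} [Fintype n] {d₁ : DecidableEq n} (d₂ : DecidableEq n)
    {A U : Matrix n n ℂ} (hU : U ∈ @Matrix.unitaryGroup n d₁ _ ℂ _ _) :
    @Matrix.groundEnergy n _ d₂ (U * A * Uᴴ) = @Matrix.groundEnergy n _ d₂ A := by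
  have e : d₁ = d₂ := Subsingleton.elim _ _
  subst e
  exact Matrix.groundEnergy_unitary_conj hU

/-- **Z₂ GAUGE INVARIANCE of the vison energy** (sorry-free): the ground energy of `z2H s` depends only on the
gauge class of the bond field — multiplying `s(x,i)` by `ε_x ε_{x+eᵢ}` for any `ε : sites → {±1}` conjugates
the Hamiltonian by the unitary `phaseGauge` (charge rotation by angle `π` on the sites with `ε = −1`, under
which hopping AND singlet pairing of a bond pick up the same factor `ε_x ε_y`).  Hence `dE(L,R)` is a function
of the two vison positions and the two holonomies only: the string may be deformed at will (e.g. run along any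
row, or any lattice path from plaquette `(R−1,0)` to plaquette `(L−1,0)`).  Every numerical test and every
proof idea on this item (cover / force telescoping / spin-smearing) uses this freedom. -/
theorem groundEnergy_z2H_gauge [NeZero L] (μ Δ₀ : ℝ) (ε : TorusSite 2 L → Bool)
    (s : TorusSite 2 L → Fin 2 → ℝ) :
    (z2H L μ Δ₀ (fun x i => ηR (ε x) * ηR (ε (x + Pi.single i 1)) * s x i)).groundEnergy =
      (z2H L μ Δ₀ s).groundEnergy := by
  have key := phaseGauge_mul_bdgTorus_mul_conjTranspose L (fun x => signCircle (ε x))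
    (fun x i => ((-(s x i) : ℝ) : ℂ)) (fun x i => ((s x i * (Δ₀ * gDir i) : ℝ) : ℂ)) μ
  simp only [coe_signCircle, Complex.conj_ofReal] at key
  have hτ : (fun x i => ((ηR (ε x) : ℝ) : ℂ) * ((ηR (ε (x + Pi.single i 1)) : ℝ) : ℂ) * ((-(s x i) : ℝ) : ℂ)) =
      (fun x i => ((-(ηR (ε x) * ηR (ε (x + Pi.single i 1)) * s x i) : ℝ) : ℂ)) := by
    funext x i; push_cast; ring
  have hΔ : (fun x i => ((ηR (ε x) : ℝ) : ℂ) * ((ηR (ε (x + Pi.single i 1)) : ℝ) : ℂ) *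
        ((s x i * (Δ₀ * gDir i) : ℝ) : ℂ)) =
      (fun x i => ((ηR (ε x) * ηR (ε (x + Pi.single i 1)) * s x i * (Δ₀ * gDir i) : ℝ) : ℂ)) := by
    funext x i; push_cast; ring
  rw [hτ, hΔ] at key
  unfold z2H
  rw [← key]
  exact groundEnergy_unitary_conj' _
    (phaseGauge_mem_unitaryGroup (fun u : FermionTorus 2 L => signCircle (ε u.toTorusSite)))

/-! ## §2 Quantifier order: at fixed `L` the bound is trivial -/

/-- For each fixed `L` (indeed for each fixed finite set of `(L,R)`) a constant exists trivially: the content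
of the crux is ONLY the uniformity of `C(μ,Δ₀)` in `L → ∞` (and `R ~ L`).  In particular no finite
computation can refute it; a kill must be an analytic lower bound growing in `L`. -/
theorem dE_bounded_fixedL (μ Δ₀ : ℝ) (L : ℕ) [NeZero L] :
    ∃ C : ℝ, ∀ R : ℕ, 2 * R ≤ L → |dE μ Δ₀ L R| ≤ C := by
  refine ⟨∑ R ∈ Finset.range (L + 1), |dE μ Δ₀ L R|, fun R hR => ?_⟩
  have hR' : R ∈ Finset.range (L + 1) := Finset.mem_range.mpr (by omega)
  exact Finset.single_le_sum (f := fun R => |dE μ Δ₀ L R|) (fun _ _ => abs_nonneg _) hR'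

/-! ## §3 Load-bearing analysis -/

/-- `R = 0`: no string, cost `0`. -/
theorem dE_zero (μ Δ₀ : ℝ) (L : ℕ) [NeZero L] : dE μ Δ₀ L 0 = 0 := sub_self _

/-- at `R = 0` every sign is `+1` (the flux-free reference). -/
theorem sgn_zero (x : TorusSite 2 L) (i : Fin 2) : sgn L 0 x i = 1 := by
  simp [sgn]

/-- For `R ≥ L` the string covers the whole row: `s_R = s_L`.  Gauge-invariantly `H L` has NO vison (both
endpoints coincide) but y-holonomy `−1` on every column: the antiperiodic twist.  So the hypothesis
`2R ≤ L` excludes nothing but the separations `R ∈ (L/2, L)` (mirror images with the complementary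
holonomy) and the pure twist `R ≥ L`. -/
theorem sgn_of_le [NeZero L] {R : ℕ} (h : L ≤ R) (x : TorusSite 2 L) (i : Fin 2) :
    sgn L R x i = sgn L L x i := by
  have hx : (x 0).val < L := ZMod.val_lt (x 0)
  have hxR : (x 0).val < R := lt_of_lt_of_le hx h
  simp [sgn, hx, hxR]

theorem visonH_of_le [NeZero L] (μ Δ₀ : ℝ) {R : ℕ} (h : L ≤ R) :
    visonH L μ Δ₀ R = visonH L μ Δ₀ L := by
  unfold visonH
  simp_rw [sgn_of_le L h]

/-- The crux with the separation constraint `2R ≤ L` dropped (all `R : ℕ`). By `visonH_of_le` this adds only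
`R ∈ (L/2, L]`; numerically (j007910, y-antiperiodic control `dE_yAP`) the pure twist costs `O(1/L)`-small
amounts, so this is NOT a refutable weakening either. -/
def VisonPairCostAllR : Prop :=
  ∀ μ : ℝ, μ ∈ Set.Ioo (-4 : ℝ) 4 → μ ≠ 0 → ∀ Δ₀ : ℝ, 0 < Δ₀ → ∃ C : ℝ,
    ∀ (L : ℕ) [NeZero L], 4 ≤ L → ∀ R : ℕ, |dE μ Δ₀ L R| ≤ C

theorem visonPairCostAllR_imp : VisonPairCostAllR → VisonPairCost := by
  rw [visonPairCost_iff]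
  intro h μ hμ hμ0 Δ₀ hΔ₀
  obtain ⟨C, hC⟩ := h μ hμ hμ0 Δ₀ hΔ₀
  exact ⟨C, fun L _ hL R _ => hC L hL R⟩

/-- The crux with ALL parameter hypotheses dropped (`μ` arbitrary real, `Δ₀` arbitrary real).  Exact numerics
(§6; L ≤ 20 locally, L ≤ 64 queued) for the dropped-hypothesis controls: μ = 0, Δ₀ = 1 (excluded van Hove
caution; still 4 cones): max|dE| ≤ 1.75, oscillating with `4 ∣ L` (node ON the momentum grid), twist cost
`c_L ≈ −18.1/L` exactly `1/L`; Δ₀ = 0, μ = −1 (metal): max|dE| ∈ [0.13, 1.60] erratic but bounded, twist cost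
`c_L = O(1)` of quasi-random sign (kink of the integrated band energy on the whole Fermi line ⇒ `O(h²)·h⁻²`);
μ = 0 ∧ Δ₀ = 0 (Lieb flux-phase regime): max|dE| = 2.59 for EVERY L ∈ {8,…,20} (flat Fermi surface, `c_L →
−3.98`), sign NEGATIVE (a π-flux pair LOWERS the energy, as Lieb 1994 suggests); μ = 4 (semi-Dirac band edge):
max|dE| = 0.033.  So NO hypothesis of the crux is load-bearing for BOUNDEDNESS — they are load-bearing for the
intended METHOD (four strictly conical nodes) and for the SIGN.  Consequently this file contains no
`_false_without_` theorem: none is available (and none is expected). -/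
def VisonPairCostNoHyp : Prop :=
  ∀ μ Δ₀ : ℝ, ∃ C : ℝ, ∀ (L : ℕ) [NeZero L], 4 ≤ L → ∀ R : ℕ, 2 * R ≤ L → |dE μ Δ₀ L R| ≤ C

theorem visonPairCostNoHyp_imp : VisonPairCostNoHyp → VisonPairCost := by
  rw [visonPairCost_iff]
  intro h μ _ _ Δ₀ _
  exact h μ Δ₀

/-! ## §4 Natural strengthenings (named; status in docstrings, updated per cycle) -/

/-- UNIFORM constant: one `C` for all `(μ, Δ₀)` in a compact parameter box.  Status (§6): plausible — every
tested point has max|dE| ≤ 2.6 (the maximum is the EXCLUDED corner μ = Δ₀ = 0); inside the crux range ≤ 1.75.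
Mechanism for uniformity in Δ₀ → 0: for `L ≲ ξ = v_F/Δ₀` the pair cost is metal-like, dominated by the
holonomy strip `c_L·R/L` with `|c_L| = O(1)` uniformly (kink quadrature bound), for `L ≫ ξ` by `2E_core + V(R)`
with `c_L = O(1/L)`. Not attacked further (outside the crux). -/
def VisonPairCostUniform : Prop :=
  ∃ C : ℝ, ∀ μ : ℝ, μ ∈ Set.Icc (-4 : ℝ) 4 → ∀ Δ₀ : ℝ, Δ₀ ∈ Set.Icc (0 : ℝ) 4 →
    ∀ (L : ℕ) [NeZero L], 4 ≤ L → ∀ R : ℕ, 2 * R ≤ L → |dE μ Δ₀ L R| ≤ C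

/-- SIGN (kill criterion K2 of the route): the vison pair COSTS energy, `dE ≥ 0`.  Status (§6): TRUE at every
tested crux-range point for L ≥ 16 (all R), e.g. `2E_core ≈ 1.45 (μ,Δ₀)=(−1,1)`, `≈ 1.0 (0.5,0.5)`, `≈ 1.3
(2,1)`, with short-range ATTRACTION `V(1) ≈ −0.4`; FALSE as a statement for all L ≥ 4: small-L / node-on-grid
exceptions exist (e.g. (−1,0.1): dE(1) < 0 at L = 10, 12, 14; (−0.3,0.2) at L = 8: c_8 < 0 makes dE(R) dip to
+0.02).  So `VisonPairCostNonneg` as literally stated (all L ≥ 4) is numerically FALSE — a Lean refutation would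
need the BdG formula (§5); the asymptotic sign is positive: K2 is NOT triggered. -/
def VisonPairCostNonneg : Prop :=
  ∀ μ : ℝ, μ ∈ Set.Ioo (-4 : ℝ) 4 → μ ≠ 0 → ∀ Δ₀ : ℝ, 0 < Δ₀ →
    ∀ (L : ℕ) [NeZero L], 4 ≤ L → ∀ R : ℕ, 2 * R ≤ L → 0 ≤ dE μ Δ₀ L R

/-- LOG FALLBACK (kill criterion K1's restatement; idea C `nambu-smearing-ward` claims it provable now by a
variational squeeze): `|dE| ≤ C (1 + log L)`. Weaker than the crux. -/
def VisonPairCostLog : Prop :=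
  ∀ μ : ℝ, μ ∈ Set.Ioo (-4 : ℝ) 4 → μ ≠ 0 → ∀ Δ₀ : ℝ, 0 < Δ₀ → ∃ C : ℝ,
    ∀ (L : ℕ) [NeZero L], 4 ≤ L → ∀ R : ℕ, 2 * R ≤ L → |dE μ Δ₀ L R| ≤ C * (1 + Real.log L)

theorem visonPairCost_imp_log : VisonPairCost → VisonPairCostLog := by
  rw [visonPairCost_iff]
  intro h μ hμ hμ0 Δ₀ hΔ₀
  obtain ⟨C, hC⟩ := h μ hμ hμ0 Δ₀ hΔ₀
  refine ⟨max C 0, fun L _ hL R hR => ?_⟩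
  have h1 : |dE μ Δ₀ L R| ≤ max C 0 := (hC L hL R hR).trans (le_max_left _ _)
  have hlog : 0 ≤ Real.log L := Real.log_natCast_nonneg L
  calc |dE μ Δ₀ L R| ≤ max C 0 := h1
    _ = max C 0 * 1 := (mul_one _).symm
    _ ≤ max C 0 * (1 + Real.log L) := by
        apply mul_le_mul_of_nonneg_left _ (le_max_right _ _)
        linarith

/-- the pure y-antiperiodic TWIST field: `−1` on every vertical bond leaving row 0 (no vison; by `visonH_of_le`
this is `H L`, the `R = L` endpoint of the crux's family). -/
def twistField (x : TorusSite 2 L) (i : Fin 2) : ℝ := if i = 1 ∧ x 1 = 0 then (-1 : ℝ) else 1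

/-- the twist cost `c_L(μ,Δ₀) = E₀(H_twist) − E₀(H_0)`. -/
def twistCost (μ Δ₀ : ℝ) (L : ℕ) [NeZero L] : ℝ :=
  (z2H L μ Δ₀ (twistField L)).groundEnergy - (z2H L μ Δ₀ (fun _ _ => 1)).groundEnergy

/-- SUB-CRUX isolated by the numerics (§6): the HOLONOMY-STRIP piece.  What the crux minimally needs is
`TwistCostBounded` (the strip contributes `≈ c_L · R/L ≤ |c_L|/2`); what is TRUE for Δ₀ > 0 is the sharper
`TwistCostDecay` (`|c_L| ≤ C/L`: numerically `|c_L|·L ≤ 14` at (−1,1) for 9 ≤ L ≤ 56, `= 18.1 ± 0.1` at (0,1) when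
`4 ∣ L`), by Poisson summation: `c_L = −L² Σ_{n ≠ 0} ĉ(Ln) ((−1)^{n₂} − 1)` with `ĉ(x)` the Fourier coefficients of
`p ↦ E(p) = √(ξ² + Δ²)`, `|ĉ(x)| ≲ |x|⁻³` (four conical tips) ⇒ `O(1/L)` with the oscillating coefficient
`F(frac(L p*/2π))` seen in the tables (node-on-grid ⇒ large negative).  For the METAL (Δ₀ = 0) only
`TwistCostBounded` survives (kink on the Fermi line ⇒ `O(1)`), and for `L ≲ v_F/Δ₀` the Δ₀ > 0 case behaves like
the metal — this is where uniformity in Δ₀ lives.  Neither statement appears in the three idea cards. -/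
def TwistCostBounded : Prop :=
  ∀ μ : ℝ, μ ∈ Set.Ioo (-4 : ℝ) 4 → μ ≠ 0 → ∀ Δ₀ : ℝ, 0 < Δ₀ → ∃ C : ℝ,
    ∀ (L : ℕ) [NeZero L], 4 ≤ L → |twistCost μ Δ₀ L| ≤ C

/-- the sharper decay law (true for Δ₀ > 0, false for the metal). -/
def TwistCostDecay : Prop :=
  ∀ μ : ℝ, μ ∈ Set.Ioo (-4 : ℝ) 4 → μ ≠ 0 → ∀ Δ₀ : ℝ, 0 < Δ₀ → ∃ C : ℝ,
    ∀ (L : ℕ) [NeZero L], 4 ≤ L → |twistCost μ Δ₀ L| ≤ C / L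

theorem twistCostDecay_imp_bounded : TwistCostDecay → TwistCostBounded := by
  intro h μ hμ hμ0 Δ₀ hΔ₀
  obtain ⟨C, hC⟩ := h μ hμ hμ0 Δ₀ hΔ₀
  refine ⟨max C 0, fun L _ hL => (hC L hL).trans ?_⟩
  have hL1 : (1 : ℝ) ≤ (L : ℝ) := by exact_mod_cast (show 1 ≤ L by omega)
  calc C / (L : ℝ) ≤ max C 0 / (L : ℝ) := by
        apply div_le_div_of_nonneg_right (le_max_left _ _) (by positivity)
    _ ≤ max C 0 := div_le_self (le_max_right _ _) hL1

/-! ## §5 The tool: BdG nuclear-norm formula (stated, not yet proved in Lean) -/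

/-- one-body hopping matrix `h_R` on `(ℤ/L)²`: `−s_R` on bonds, `−μ` on the diagonal. -/
def hMat (μ : ℝ) (R : ℕ) : Matrix (TorusSite 2 L) (TorusSite 2 L) ℂ :=
  fun x y => (if x = y then (-(μ : ℂ)) else 0)
    + ∑ i : Fin 2, ((if y = x + Pi.single i 1 then -sgn L R x i else 0)
                    + (if x = y + Pi.single i 1 then -sgn L R y i else 0))

/-- one-body d-wave gap matrix `Δ_R`: `s_R Δ₀ gᵢ` on bonds (overall sign immaterial). -/
def dMat (Δ₀ : ℝ) (R : ℕ) : Matrix (TorusSite 2 L) (TorusSite 2 L) ℂ :=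
  fun x y => ∑ i : Fin 2, ((Δ₀ * (if i = 0 then (1 : ℝ) else -1) : ℝ) : ℂ) *
    ((if y = x + Pi.single i 1 then sgn L R x i else 0) + (if x = y + Pi.single i 1 then sgn L R y i else 0))

/-- the complex symmetric one-body matrix `A_R = h_R + i Δ_R`. -/
def nambuA (μ Δ₀ : ℝ) (R : ℕ) : Matrix (TorusSite 2 L) (TorusSite 2 L) ℂ :=
  hMat L μ R + Complex.I • dMat L Δ₀ R

/-- nuclear norm `‖A‖_* = Σ_k σ_k(A) = Σ_k √λ_k(A Aᴴ)`. -/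
def nuclearNorm {n : Type} [Fintype n] [DecidableEq n] (A : Matrix n n ℂ) : ℝ :=
  ∑ k, Real.sqrt ((Matrix.isHermitian_mul_conjTranspose_self A).eigenvalues k)

/-- THE BdG FORMULA used by every numerical test on this item (j000170, j000990, j005308, j007910) and the entry
point of any proof: `E₀(H_R) = −μ L² − ‖h_R + iΔ_R‖_*`.  Reason: with Nambu spinors `Ψ = (c_↑, c†_↓)` one has
`H_R = Ψ† M_R Ψ + Tr h_R`, `M_R = [[h_R, −Δ_R],[−Δ_R, −h_R]]` (real symmetric blocks), and `M_R² ≅ A_R A_R†`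
under `(u,v) ↦ u + iv`, so `spec M_R = {±σ_k(A_R)}` and the Fock minimum fills the negative modes.  Hence
`dE(L,R) = −(‖A_R‖_* − ‖A_0‖_*)` (`Tr h_R = −μL²` is `R`-independent).  Not provable in the tree today
(no diagonalisation of fermionic quadratic forms); recorded so that provers and later disprovers test the SAME
quantity. -/
def BdGNuclearNormFormula : Prop :=
  ∀ (μ Δ₀ : ℝ) (L : ℕ) [NeZero L], 3 ≤ L → ∀ R : ℕ,
    (visonH L μ Δ₀ R).groundEnergy = -μ * (L : ℝ) ^ 2 - nuclearNorm (nambuA L μ Δ₀ R)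

/-! ## §6 Numerical record and why the crux resists (cycle 1, final)

All numbers: exact BdG evaluation `dE(L,R) = −(‖A_R‖_* − ‖A_0‖_*)` (§5).  Sources: kit jobs j008088–j008093
(`L ≤ 40` all `R` by complex SVD, `L = 48, 56 (64 partial)` all `R` by `eigvalsh(A A†)`; svd/gram cross-check at
L = 40: `≤ 1.5·10⁻¹¹`; free-fermion check `|‖A_0‖_* − Σ_p E(p)| ≤ 1.5·10⁻¹¹`) and the hub's pure-python
Householder/QL runs (L ≤ 24); aggregated table `numerics_all.md` attached to the item (16 parameter points ×
17 sizes, every R).  Literature anchor (the exact cousin, read this cycle): Kitaev, Ann. Phys. 321 (2006) 2,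
arXiv:cond-mat/0506438 §11 (p. 29 of the arXiv text): in the GAPLESS phase `J_x = J_y = J_z` (two Dirac cones,
Z₂ vortices = visons, energies from the singular values of an `N×N` matrix, `L ≤ 50`) "the energy of an isolated
vortex is `E_vortex ≈ 0.1536` above the ground state", extrapolated with `E(L) = E_vortex + a₁L⁻¹ + a₂L⁻²`,
"the energy of a vortex pair is smaller than `2E_vortex` if the vortices are close: by ≈ 0.04 (nn), ≈ 0.07 (nnn)",
and the finite-size energy oscillates with the commensurability of the node `q*` with the torus ("each period
`r` contributes `∼ |r|⁻¹ cos(2(q*,r))`") — finite core energy, `1/L` corrections, short-range attraction,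
node–grid oscillations: the same four features as below.

TABLE — `max_{1≤R≤L/2} |dE|` at L = 16, 20, 24, 28, 32, 40, 48, 56 (crux range first):
* (μ,Δ₀) = (−2, 0.5):  0.92 0.94 0.62 0.92 0.93 0.92 0.77 0.92   — plateau 0.92;  dE(1) → 0.564, dE(2) → 0.707.
* (−1, 1):              1.62 1.47 1.26 1.43 1.57 1.60 1.46 1.57 (64: 1.54, R ≤ 11) — plateau 1.52 ± 0.03; dE(1) → 1.049, dE(2) → 1.172.
* (−1, 3):              1.52 1.46 1.26 1.51 1.70 1.78 (L ≤ 40)   — plateau ≈ 1.85 approached from below (c_L = −1.0 … −0.4 large: v_Δ = 8.2).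
* (−1, 0.1):            0.37 0.34 0.25 0.24 0.35 0.17 0.12 0.33   — metal-like window (ξ = v_F/Δ₀ ≈ 27), |c_L| ≤ 0.76 erratic, all small.
* (−0.3, 0.2):          0.54 0.56 0.52 0.40 0.30 0.27 0.29 (L ≤ 48) — ROSE while L ≲ ξ ≈ 14–20, TURNED OVER at L ≈ 20 as predicted.
* (0.5, 0.5):           1.07 1.02 0.99 1.01 1.04 1.04 0.93 1.00   — plateau 0.99 ± 0.03; dE(1) → 0.628, dE(2) → 0.757.
* (2, 1):               1.34 1.36 0.95 1.34 1.35 1.35 1.15 (1.27) — plateau 1.35; 3 ∣ L puts the node ON the grid (L = 6, 9, 12, 24, 48 dips).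
* (3.5, 1):             0.55 0.53 0.41 0.53 0.54 0.52 0.50 0.54   — plateau 0.53 (band edge near: small cost).
* controls (hypotheses dropped): (0,1) [μ = 0, 4 ∣ L ⇒ node on grid for every L listed] 0.99 1.14 1.23 1.29 1.33 1.40 1.44 1.48,
  rising to the plateau ≈ 1.6 as `c_L = −18.0/L` (c_L·L = −18.1, −18.0, −18.0, −18.0, −18.0, −18.0, −17.96 for L = 16 … 56) dies out;
  (−1,0) METAL 0.26 0.30 0.98 0.45 0.24 0.26 0.55 (0.18) erratic, |c_L| ≤ 1.45, bounded; (−1,0.02) 0.28 0.11 0.74 0.30 0.20 0.12 (L ≤ 40);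
  (0,0) LIEB REGIME 2.592 2.587 2.582 2.578 2.575 2.570 2.567 2.564 with `c_L → −4` (−3.9968 at L = 56; `c_L = +4.0000` exactly at odd
  L = 5, 7, 9), sign NEGATIVE; (4,1) semi-Dirac 0.0329 … 0.0337; (5,1) gapped 0.0130 (converged to all digits by L = 12).
PROFILES (strip-corrected `dE(R) − c_L·R/L`, which agree across L = 32 … 64 to ±0.02): (−1,1): R = 1 … 8 ↦ 1.05, 1.17, 1.33, 1.42,
1.40, 1.50, 1.46, 1.50, then plateau 1.50–1.55 with an even/odd-R ripple (inter-node interference); (0.5,0.5): 0.63, 0.76, 0.89, 0.90,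
0.95, 0.95, 0.96, 0.98 → 0.99.  So `V(1) ≈ −0.47 / −0.36`, `V(2) ≈ −0.35 / −0.23`, `V(4) ≈ −0.10`: short-range ATTRACTION, decaying.
TWIST COST `c_L·L` at (−1,1) versus `θ_L = frac(L p*/2π)`, `cos p* = 1/4`: θ = .035 ↦ −14.1, .069 ↦ −11.0, .098 ↦ −8.8, .196 ↦ −2.2,
.357 ↦ +2.8, .391 ↦ +2.8, .517 ↦ +3.3, .713 ↦ +1.0, .748 ↦ −0.03, .874 ↦ −6.9, .888 ↦ −8.6, .937 ↦ −12.0 — ONE bounded periodic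
function `F(θ)`: `c_L = F(frac(L p*/2π))/L + o(1/L)`, exactly the Poisson-summation law behind `TwistCostDecay` (§4).

THE LAW the tables obey (predicted before the runs, NOTES P1–P2):
  `dE(L,R) = 2E_core(μ,Δ₀) + V(R) + c_L · R/L + O(0.02)`   (L ≥ 32),
(i) `E_core` = lattice-scale self-energy of one Z₂ flux for the BdG sea (`2E_core + V(∞)` = 1.52 (−1,1), 0.99 (0.5,0.5), 1.35 (2,1),
0.92 (−2,0.5), 0.53 (3.5,1); NEGATIVE −2.6 at μ = Δ₀ = 0); (ii) `V(R) → 0`, attractive at short range; (iii) the HOLONOMY STRIP: the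
`R` columns between the visons carry y-holonomy `−1` and cost the fraction `R/L` of the twist cost `c_L`, a lattice-sum
(trapezoidal-rule) error of `Σ_p E(p)` under `p₂ ↦ p₂ + π/L`: `F(θ_L)/L` for conical point nodes (Δ₀ > 0, L ≫ ξ), `O(1)`
erratic but bounded for a Fermi LINE (Δ₀ = 0, or Δ₀ > 0 with L ≲ ξ = v_F/Δ₀), `→ −4` for the flat nested square (μ = Δ₀ = 0).
Every term is bounded uniformly in (L,R); none grows, at ANY of the 16 parameter points, in or out of the hypotheses.  The "why it
might fail" mechanisms do not bite: the marginal `r^{-1/2}` Dirac–Aharonov–Bohm modes give an ENERGY-INDEPENDENT spectral shift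
(scale invariance) ⇒ O(1) lattice-scale `E_core`, no `log L`; the column holonomies give the bounded ramp (iii), not `log R`;
inter-vison hybridisation is `V(R) → 0`.

WHY NO LEAN KILL IS POSSIBLE EVEN IN PRINCIPLE HERE: the crux is `∃ C ∀ L`, so finitely many evaluations never refute it
(`dE_bounded_fixedL`); a kill needs an analytic lower bound growing in `L`, and every analytic handle (Krein spectral shift,
twist quadrature error, variational log squeeze) points to boundedness.  VERDICT OF THE STANDING DISPROVER: the crux is TRUE
with `C(μ,Δ₀) ≈ 1.0–1.9` on the tested range (largest finite-L excursions at L ≤ 7).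

WHAT A PROVER SHOULD TAKE FROM THIS FILE: (1) work with `bdgTorus` and the landed gauge invariance (`GaugeStructure`,
p73434); (2) the BdG nuclear-norm formula §5 is the first formalisation target (translation-invariant half exists:
`DWaveSourceFreePressure`); (3) a proof must control THREE pieces — core (local; Krein/resolvent), interaction (decay of the
one-vison resolvent difference, idea B), and the HOLONOMY STRIP = `TwistCostBounded`/`TwistCostDecay` (§4; Poisson summation +
`|ĉ(x)| ≲ |x|⁻³` for the cone tips) — the strip is MISSING from all three idea cards, is exactly idea B's non-decaying `+1/L`
part of the force, and is where uniformity in Δ₀ lives (for L ≲ v_F/Δ₀ it is O(1), not small); (4) the variational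
spin-smearing squeeze gives only `O(log R)` (idea C): it cannot see the screening; (5) finite-size corrections to `E_core` are
`O(1/L)` with coefficients up to ≈ 3 when a node sits on the momentum grid (μ = 0, 4 ∣ L), cf. Kitaev's three-branch
extrapolation.
-/

/-! ## §7 Near-misses (sorried ONLY here; each with its obstruction) -/

/-- NEAR-MISS (refuted strengthening, numerically certain, not closable in Lean today):
`VisonPairCostNonneg` — "the pair never lowers the energy, for all L ≥ 4" — is FALSE: exact BdG evaluation gives
`dE(L=10,R=1; μ=−1, Δ₀=0.1) = −0.0593`, `dE(12,1;−1,0.1) = −0.1103`, `dE(12,2;−1,0.1) = −0.1118`,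
`dE(14,1;−1,0.1) = −0.0199` (table §6 / `numerics_local.md`; free-fermion check 10⁻¹³).  Obstruction to a
Lean proof: `Matrix.groundEnergy` of the `4^{L²}`-dimensional `H R` is only reachable through the BdG
nuclear-norm formula (§5, `BdGNuclearNormFormula`), i.e. the diagonalisation of a NON-translation-invariant
fermionic quadratic form with pairing (Bloch–Messiah), which the tree does not have (it has the
translation-invariant case: `DWaveSourceFreePressure`, `BlochBogoliubovImplementer`); with it, the witness is a
certified interval computation on a 200×200 real symmetric matrix.  Tried: nothing cheaper exists (the sign is
not decided by any variational one-liner: both `E₀(H_R) ≤ ⟨ψ_0,H_Rψ_0⟩` and its mirror only give upper bounds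
on a DIFFERENCE). -/
theorem visonPairCostNonneg_false : ¬ VisonPairCostNonneg := by
  sorry

end

end Summit.HubbardSuperconductivity.HubbardSuperconductivity.Cruxes.VisonPairCost.Disproof
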